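import Mathlib
import Summits.CriticalPhenomena.PercolationContinuityZ3.Theses.PercBudgetLadder
import Summits.CriticalPhenomena.PercolationContinuityZ3.Theorems.PinholeClosing.Negative.PinholeClosingBaseline
import Summits.CriticalPhenomena.PercolationContinuityZ3.Theorems.PercBudgetLadderPinholeClosingZeroRung
import Summits.CriticalPhenomena.PercolationContinuityZ3.Theorems.PercBudgetLadderPinholeClosingBDPairing
import Summits.CriticalPhenomena.PercolationContinuityZ3.Theorems.PercBudgetLadderPinholeClosingBDCauchySchwarz
import Literature.Probability.Percolation.MinOpenCut
import HarnessLib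

/-!
# Crux `PercBudgetLadder.PinholeClosing` (stmt-CriticalPhenomena-5249), line `balanced-deletion` — the certified REDUCTION

Helper file for the crux skeleton `Cruxes/PinholeClosing/Lines/balanced_deletion.lean` (lead
`prover-line-stmt-CriticalPhenomena-5249-c1-0`), `--supports stmt-CriticalPhenomena-5249`.  No new definitions (local
notation as in `…BDPairing.lean`).

Main result `BalancedDeletion.pinholeClosing_of_balancedSecondMoment`:

  `(∀ k l, 2 ≤ l → ∃ K, ∀ n ≥ 1, E[ MD(n,2ln)² ; BUD(n,2ln) = k+1 ] ≤ K) → PercBudgetLadder.PinholeClosing`,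

the hypothesis being VERBATIM the registered open stub `stub_balancedSecondMoment` of the line (the bet: a uniform-in-`n`
second moment of the discounted closed-pivotal count on the conclusion level, at the conclusion shape).  Level `0` of the crux is
the landed theorem `pinholeClosing_zero` (line `halfspace-polarisation`); level `k+1 ≥ 1` is `BalancedDeletion.level_step`:
the premise at `(n, ln)` gives `P(BUD(n,2ln) ≤ k+2) ≥ c` (aspect monotonicity); either `P(BUD ≤ k+1) ≥ c/2`, or the exact level
`k+2` has mass `≥ c/2`, and then the pairing identity (`BDPairing`) gives `E[MD ; BUD = k+1] ≥ (1-p_c) c/2`, whence by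
Cauchy–Schwarz (`stub_cauchySchwarz`) `P(BUD = k+1) ≥ ((1-p_c) c/2)² / max K 1`.
-/

namespace Summit.CriticalPhenomena.PercolationContinuityZ3.Theorems

open MeasureTheory Finset
open Literature.Probability.Percolation Literature.Probability.LatticeModels
open Summit.CriticalPhenomena.PercolationContinuityZ3.Theses
open Summit.CriticalPhenomena.PercolationContinuityZ3.Theorems.PinholeClosing.Negative

namespace BalancedDeletion

local notation3 "μc" => bondPercolation (zdGraph 3) (criticalProbI 3)
local notation3 "pc" => ((criticalProbI 3 : unitInterval) : ℝ)
local notation3 "BUD[" n ", " m ", " η "]" =>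
  minOpenCutIn (↑(box 3 m) : Set (Site 3)) (↑(box 3 n) : Set (Site 3)) (↑(innerBoundary (zdGraph 3) (box 3 m)) : Set (Site 3)) η
local notation3 "LEV[" n ", " m ", " j "]" => {ω : BondConfig (Site 3) | BUD[n, m, ω] = ((j : ℕ) : ℕ∞)}
local notation3 "BEV[" k ", " n ", " m "]" =>
  {ω : BondConfig (Site 3) | ∃ S : Finset (Sym2 (Site 3)), S.card ≤ k ∧ ¬ ∃ x ∈ box 3 n,
    ∃ y ∈ innerBoundary (zdGraph 3) (box 3 m), (ω \ (↑S : Set (Sym2 (Site 3)))) ∈ openConnIn (↑(box 3 m) : Set (Site 3)) x y}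
local notation3 "ISB[" n ", " m ", " η ", " b "]" => (b ∈ η ∧ BUD[n, m, η \ {b}] + 1 ≤ BUD[n, m, η])
local notation3 "NB[" n ", " m ", " η "]" =>
  ∑ b ∈ edgesIn (zdGraph 3) (box 3 m), {ζ : BondConfig (Site 3) | ISB[n, m, ζ, b]}.indicator (fun _ => (1 : ℝ)) η
local notation3 "ISC[" n ", " m ", " η ", " f "]" => (f ∉ η ∧ BUD[n, m, η] + 1 ≤ BUD[n, m, insert f η])
local notation3 "MD[" n ", " m ", " ω "]" =>
  ∑ f ∈ edgesIn (zdGraph 3) (box 3 m),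
    {η : BondConfig (Site 3) | ISC[n, m, η, f]}.indicator (fun η => 1 / NB[n, m, insert f η]) ω

local notation3 "NC[" n ", " m ", " ω "]" =>
  ∑ f ∈ edgesIn (zdGraph 3) (box 3 m), {η : BondConfig (Site 3) | ISC[n, m, η, f]}.indicator (fun _ => (1 : ℝ)) ω

/-! ### A deterministic sharpening of the bet: `MD ≤ #ClPiv / (#Bneck + 1)` -/

/-- A bottleneck stays a bottleneck after opening a closed pivotal edge. [folklore] -/
theorem isb_insert_of_isc {n m : ℕ} {ω : BondConfig (Site 3)} {f b : Sym2 (Site 3)}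
    (hf : ISC[n, m, ω, f]) (hb : ISB[n, m, ω, b]) : ISB[n, m, insert f ω, b] := by
  have hbf : b ≠ f := fun h => hf.1 (h ▸ hb.1)
  refine ⟨Set.mem_insert_of_mem f hb.1, ?_⟩
  have hset : insert f ω \ {b} = insert f (ω \ {b}) := by
    ext e
    simp only [Set.mem_sdiff, Set.mem_insert_iff, Set.mem_singleton_iff]
    constructor
    · rintro ⟨h | h, hne⟩
      · exact Or.inl h
      · exact Or.inr ⟨h, hne⟩
    · rintro (h | ⟨h, hne⟩)
      · exact ⟨Or.inl h, fun hb' => hbf (hb'.symm.trans h)⟩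
      · exact ⟨Or.inr h, hne⟩
  rw [hset]
  have h1 : BUD[n, m, insert f (ω \ {b})] ≤ BUD[n, m, ω \ {b}] + 1 :=
    (BalancedDeletion.stub_budgetOneEdge n m (ω \ {b}) f).2.1
  calc BUD[n, m, insert f (ω \ {b})] + 1 ≤ BUD[n, m, ω \ {b}] + 1 + 1 := add_le_add h1 le_rfl
    _ ≤ BUD[n, m, ω] + 1 := add_le_add hb.2 le_rfl
    _ ≤ BUD[n, m, insert f ω] := hf.2

/-- The opened closed-pivotal edge is itself a bottleneck of the new configuration. [folklore] -/
theorem isb_self_of_isc {n m : ℕ} {ω : BondConfig (Site 3)} {f : Sym2 (Site 3)} (hf : ISC[n, m, ω, f]) :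
    ISB[n, m, insert f ω, f] := by
  refine ⟨Set.mem_insert f ω, ?_⟩
  have hset : insert f ω \ {f} = ω := by
    rw [← Set.union_singleton, Set.union_sdiff_right, Set.sdiff_singleton_eq_self hf.1]
  rw [hset]
  exact hf.2

/-- Opening a closed pivotal edge of `edgesIn (box m)` raises the bottleneck count by at least one. [folklore] -/
theorem nb_add_one_le_nb_insert {n m : ℕ} {ω : BondConfig (Site 3)} {f : Sym2 (Site 3)}
    (hfB : f ∈ edgesIn (zdGraph 3) (box 3 m)) (hf : ISC[n, m, ω, f]) : NB[n, m, ω] + 1 ≤ NB[n, m, insert f ω] := by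
  have hsplit : ∀ η : BondConfig (Site 3), NB[n, m, η] =
      (∑ b ∈ (edgesIn (zdGraph 3) (box 3 m)).erase f, {ζ : BondConfig (Site 3) | ISB[n, m, ζ, b]}.indicator (fun _ => (1 : ℝ)) η) +
        {ζ : BondConfig (Site 3) | ISB[n, m, ζ, f]}.indicator (fun _ => (1 : ℝ)) η := by
    intro η
    rw [← Finset.sum_erase_add _ _ hfB]
  rw [hsplit ω, hsplit (insert f ω)]
  have hf0 : {ζ : BondConfig (Site 3) | ISB[n, m, ζ, f]}.indicator (fun _ => (1 : ℝ)) ω = 0 :=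
    Set.indicator_of_notMem (fun h => hf.1 h.1) _
  have hf1 : {ζ : BondConfig (Site 3) | ISB[n, m, ζ, f]}.indicator (fun _ => (1 : ℝ)) (insert f ω) = 1 :=
    Set.indicator_of_mem (show insert f ω ∈ {ζ : BondConfig (Site 3) | ISB[n, m, ζ, f]} from isb_self_of_isc hf)
      (fun _ => (1 : ℝ))
  rw [hf0, hf1, add_zero]
  refine add_le_add (Finset.sum_le_sum fun b _ => ?_) le_rfl
  by_cases hb : ISB[n, m, ω, b]
  · rw [Set.indicator_of_mem (show ω ∈ {ζ : BondConfig (Site 3) | ISB[n, m, ζ, b]} from hb),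
      Set.indicator_of_mem (show insert f ω ∈ {ζ : BondConfig (Site 3) | ISB[n, m, ζ, b]} from isb_insert_of_isc hf hb)]
  · rw [Set.indicator_of_notMem (show ω ∉ {ζ : BondConfig (Site 3) | ISB[n, m, ζ, b]} from hb)]
    exact Set.indicator_nonneg (fun _ _ => zero_le_one) _

/-- **`MD ≤ #ClPiv / (#Bneck + 1)`**: the discounted closed-pivotal count of a configuration is at most its number of closed
pivotal edges divided by one plus its number of bottlenecks — so the bet of the line follows from the L² balance of the two plain
counts on one level. [folklore] -/
theorem md_le_nc_div (n m : ℕ) (ω : BondConfig (Site 3)) : MD[n, m, ω] ≤ NC[n, m, ω] / (NB[n, m, ω] + 1) := by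
  have hN : 0 < NB[n, m, ω] + 1 := by linarith [Pairing.nb_nonneg n m ω]
  rw [Finset.sum_div]
  refine Finset.sum_le_sum fun f hfB => ?_
  by_cases hf : ISC[n, m, ω, f]
  · rw [Set.indicator_of_mem (show ω ∈ {η : BondConfig (Site 3) | ISC[n, m, η, f]} from hf),
      Set.indicator_of_mem (show ω ∈ {η : BondConfig (Site 3) | ISC[n, m, η, f]} from hf)]
    exact one_div_le_one_div_of_le hN (nb_add_one_le_nb_insert hfB hf)
  · rw [Set.indicator_of_notMem (show ω ∉ {η : BondConfig (Site 3) | ISC[n, m, η, f]} from hf),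
      Set.indicator_of_notMem (show ω ∉ {η : BondConfig (Site 3) | ISC[n, m, η, f]} from hf), zero_div]

/-- The route's budget event is `{BUD ≤ k}` (`minOpenCutIn_le_iff`). [folklore] -/
theorem bev_eq (k n m : ℕ) : BEV[k, n, m] = {ω : BondConfig (Site 3) | BUD[n, m, ω] ≤ (k : ℕ∞)} := by
  ext ω
  exact (minOpenCutIn_le_iff (S := (↑(box 3 m) : Set (Site 3))) (A := (↑(box 3 n) : Set (Site 3)))
    (B := (↑(innerBoundary (zdGraph 3) (box 3 m)) : Set (Site 3))) (ω := ω) (k := k)).symm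

/-- `{BUD = j} ⊆ {BUD ≤ j}`. [folklore] -/
theorem lev_subset_bev (j n m : ℕ) : LEV[n, m, j] ⊆ BEV[j, n, m] := by
  intro ω hω
  rw [bev_eq]
  exact le_of_eq hω

/-- `{BUD ≤ j+1} ⊆ {BUD ≤ j} ∪ {BUD = j+1}` (budgets are finite for `n < m`). [folklore] -/
theorem bev_succ_subset_union {j n m : ℕ} (hnm : n < m) :
    BEV[j + 1, n, m] ⊆ BEV[j, n, m] ∪ LEV[n, m, j + 1] := by
  intro ω hω
  rw [bev_eq] at hω
  have hfin : BUD[n, m, ω] ≠ ⊤ := (BalancedDeletion.stub_budgetOneEdge n m ω s(0, 0)).2.2.1 hnm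
  obtain ⟨a, ha⟩ := ENat.ne_top_iff_exists.1 hfin
  have hle : (a : ℕ∞) ≤ ((j + 1 : ℕ) : ℕ∞) := by rw [ha]; exact_mod_cast hω
  have hle' : a ≤ j + 1 := by exact_mod_cast hle
  rcases Nat.lt_or_ge a (j + 1) with hlt | hge
  · left
    rw [bev_eq]
    change BUD[n, m, ω] ≤ (j : ℕ∞)
    rw [← ha]; exact_mod_cast Nat.lt_succ_iff.1 hlt
  · right
    change BUD[n, m, ω] = ((j + 1 : ℕ) : ℕ∞)
    rw [← ha]; exact_mod_cast le_antisymm hle' hge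

/-- **The lever at level `k+1`.**  From a second-moment bound `K` for `MD` on `{BUD(n,2ln) = k+1}`:
`P(BEV (k+2) (n, ln)) ≥ c` implies `P(BEV (k+1) (n, 2ln)) ≥ min (c/2) (((1-p_c)(c/2))² / max K 1)`. [folklore] -/
theorem level_step {k l n : ℕ} {c K : ℝ} (hl : 2 ≤ l) (hn : 1 ≤ n) (hc : 0 < c)
    (hK : ∫ ω in LEV[n, 2 * l * n, k + 1], (MD[n, 2 * l * n, ω]) ^ 2 ∂μc ≤ K)
    (hprem : c ≤ (μc).real (BEV[k + 1 + 1, n, l * n])) :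
    min (c / 2) (((1 - pc) * (c / 2)) ^ 2 / max K 1) ≤ (μc).real (BEV[k + 1, n, 2 * l * n]) := by
  set m := l * n with hm
  set M := 2 * l * n with hM
  have hnm : n ≤ m := by rw [hm]; nlinarith
  have hmM : m ≤ M := by rw [hm, hM]; nlinarith
  have hnM : n < M := by rw [hM]; nlinarith
  have hpremM : c ≤ (μc).real (BEV[k + 1 + 1, n, M]) :=
    hprem.trans (blockProb_mono_aspect (k := k + 1 + 1) hnm hmM)
  by_cases hcase : c / 2 ≤ (μc).real (BEV[k + 1, n, M])
  · exact (min_le_left _ _).trans hcase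
  · have hcase' : (μc).real (BEV[k + 1, n, M]) < c / 2 := not_le.mp hcase
    have hlev : c / 2 ≤ (μc).real (LEV[n, M, k + 1 + 1]) := by
      have h1 : (μc).real (BEV[k + 1 + 1, n, M]) ≤ (μc).real (BEV[k + 1, n, M]) + (μc).real (LEV[n, M, k + 1 + 1]) :=
        (measureReal_mono (bev_succ_subset_union (j := k + 1) hnM)).trans (measureReal_union_le _ _)
      linarith
    have hpair := Pairing.pairing_identity (j := k + 1) (n := n) (m := M) hnM
    set s := LEV[n, M, k + 1] with hs
    set I : ℝ := ∫ ω in s, MD[n, M, ω] ∂μc with hI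
    have hsm : MeasurableSet s := Pairing.measurableSet_lev (k + 1) n M
    have hI0 : 0 ≤ I := setIntegral_nonneg hsm fun ω _ => Pairing.md_nonneg n M ω
    have hpc1 : pc ≤ 1 := (criticalProbI 3).2.2
    have hq0 : 0 ≤ 1 - pc := sub_nonneg.2 hpc1
    have hIlow : (1 - pc) * (c / 2) ≤ I := by
      have h1 : (1 - pc) * (c / 2) ≤ (1 - pc) * (μc).real (LEV[n, M, k + 1 + 1]) :=
        mul_le_mul_of_nonneg_left hlev hq0
      have h2 : pc * I ≤ I := by nlinarith
      linarith [hpair]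
    -- Cauchy–Schwarz with g = 𝟙_s · MD
    set g : BondConfig (Site 3) → ℝ := s.indicator (fun ω => MD[n, M, ω]) with hg
    have hgm : Measurable g := (Pairing.measurable_md n M).indicator hsm
    have hg0 : ∀ ω, 0 ≤ g ω := fun ω => Set.indicator_nonneg (fun η _ => Pairing.md_nonneg n M η) ω
    have hgC : ∀ ω, g ω ≤ ((edgesIn (zdGraph 3) (box 3 M)).card : ℝ) := by
      intro ω
      by_cases h : ω ∈ s
      · simp only [hg]; rw [Set.indicator_of_mem h]; exact Pairing.md_le n M ω
      · simp only [hg]; rw [Set.indicator_of_notMem h]; positivity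
    have hCS := BalancedDeletion.stub_cauchySchwarz g s _ hsm hgm hg0 hgC
    have hIg : ∫ ω in s, g ω ∂μc = I := by
      rw [hI]
      exact setIntegral_congr_fun hsm fun ω hω => by simp only [hg]; rw [Set.indicator_of_mem hω]
    have hg2 : ∫ ω, g ω ^ 2 ∂μc = ∫ ω in s, (MD[n, M, ω]) ^ 2 ∂μc := by
      rw [← integral_indicator hsm]
      refine integral_congr_ae (ae_of_all _ fun ω => ?_)
      by_cases h : ω ∈ s
      · simp only [hg]; rw [Set.indicator_of_mem h, Set.indicator_of_mem h]
      · simp only [hg]; rw [Set.indicator_of_notMem h, Set.indicator_of_notMem h]; ring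
    rw [hIg, hg2] at hCS
    have hqc : 0 ≤ (1 - pc) * (c / 2) := mul_nonneg hq0 (by linarith)
    have hsq : ((1 - pc) * (c / 2)) ^ 2 ≤ (μc).real s * max K 1 := by
      calc ((1 - pc) * (c / 2)) ^ 2 ≤ I ^ 2 := pow_le_pow_left₀ hqc hIlow 2
        _ ≤ (μc).real s * ∫ ω in s, (MD[n, M, ω]) ^ 2 ∂μc := hCS
        _ ≤ (μc).real s * max K 1 := mul_le_mul_of_nonneg_left (hK.trans (le_max_left K 1)) measureReal_nonneg
    have hmax : 0 < max K 1 := lt_of_lt_of_le one_pos (le_max_right K 1)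
    refine (min_le_right _ _).trans ?_
    rw [div_le_iff₀ hmax]
    exact hsq.trans (mul_le_mul_of_nonneg_right (measureReal_mono (lev_subset_bev (k + 1) n M)) hmax.le)

/-- **Level `k+1 ≥ 1` of the crux from the bet at level `k+1`.** [folklore] -/
theorem levelSucc_of_bet (k l : ℕ) (c : ℝ) (hl : 2 ≤ l) (hc : 0 < c)
    (hbet : ∃ K : ℝ, ∀ n : ℕ, 1 ≤ n → ∫ ω in LEV[n, 2 * l * n, k + 1], (MD[n, 2 * l * n, ω]) ^ 2 ∂μc ≤ K) :
    ∃ c' : ℝ, 0 < c' ∧ ∀ n : ℕ, 1 ≤ n →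
      c ≤ (μc).real (BEV[k + 1 + 1, n, l * n]) → c' ≤ (μc).real (BEV[k + 1, n, 2 * l * n]) := by
  obtain ⟨K, hK⟩ := hbet
  refine ⟨min (c / 2) (((1 - pc) * (c / 2)) ^ 2 / max K 1), ?_, fun n hn hprem => ?_⟩
  · refine lt_min (by linarith) (div_pos (pow_pos (mul_pos (sub_pos.2 pc_lt_one) (by linarith)) 2)
      (lt_of_lt_of_le one_pos (le_max_right K 1)))
  · exact level_step hl hn hc (hK n hn) hprem

/-- **The lever at level `k+1`, uniform-integrability form** (layer-cake instead of Cauchy–Schwarz): if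
`∫_{BUD = k+1, MD > K₀} MD ≤ (1-p_c) c / 4` at the conclusion shape, then `P(BEV (k+2) (n, ln)) ≥ c` implies
`P(BEV (k+1) (n, 2ln)) ≥ min (c/2) ((1-p_c) c / (4 max K₀ 1))`. [folklore] -/
theorem level_step_UI {k l n : ℕ} {c K₀ : ℝ} (hl : 2 ≤ l) (hn : 1 ≤ n)
    (hK : ∫ ω in LEV[n, 2 * l * n, k + 1] ∩ {ω : BondConfig (Site 3) | K₀ < MD[n, 2 * l * n, ω]}, MD[n, 2 * l * n, ω] ∂μc ≤
      (1 - pc) * c / 4)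
    (hprem : c ≤ (μc).real (BEV[k + 1 + 1, n, l * n])) :
    min (c / 2) ((1 - pc) * c / (4 * max K₀ 1)) ≤ (μc).real (BEV[k + 1, n, 2 * l * n]) := by
  set m := l * n with hm
  set M := 2 * l * n with hM
  have hnm : n ≤ m := by rw [hm]; nlinarith
  have hmM : m ≤ M := by rw [hm, hM]; nlinarith
  have hnM : n < M := by rw [hM]; nlinarith
  have hpremM : c ≤ (μc).real (BEV[k + 1 + 1, n, M]) :=
    hprem.trans (blockProb_mono_aspect (k := k + 1 + 1) hnm hmM)
  by_cases hcase : c / 2 ≤ (μc).real (BEV[k + 1, n, M])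
  · exact (min_le_left _ _).trans hcase
  · have hcase' : (μc).real (BEV[k + 1, n, M]) < c / 2 := not_le.mp hcase
    have hlev : c / 2 ≤ (μc).real (LEV[n, M, k + 1 + 1]) := by
      have h1 : (μc).real (BEV[k + 1 + 1, n, M]) ≤ (μc).real (BEV[k + 1, n, M]) + (μc).real (LEV[n, M, k + 1 + 1]) :=
        (measureReal_mono (bev_succ_subset_union (j := k + 1) hnM)).trans (measureReal_union_le _ _)
      linarith
    have hpair := Pairing.pairing_identity (j := k + 1) (n := n) (m := M) hnM
    set s := LEV[n, M, k + 1] with hs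
    set I : ℝ := ∫ ω in s, MD[n, M, ω] ∂μc with hI
    have hsm : MeasurableSet s := Pairing.measurableSet_lev (k + 1) n M
    have hI0 : 0 ≤ I := setIntegral_nonneg hsm fun ω _ => Pairing.md_nonneg n M ω
    have hpc1 : pc ≤ 1 := (criticalProbI 3).2.2
    have hq0 : 0 ≤ 1 - pc := sub_nonneg.2 hpc1
    have hIlow : (1 - pc) * (c / 2) ≤ I := by
      have h1 : (1 - pc) * (c / 2) ≤ (1 - pc) * (μc).real (LEV[n, M, k + 1 + 1]) :=
        mul_le_mul_of_nonneg_left hlev hq0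
      have h2 : pc * I ≤ I := by nlinarith
      linarith [hpair]
    -- layer cake: I ≤ K' P(s) + ∫_{s ∩ {MD > K₀}} MD with K' = max K₀ 1
    set K' : ℝ := max K₀ 1 with hK'
    have hK'pos : 0 < K' := lt_of_lt_of_le one_pos (le_max_right _ _)
    have hTm : MeasurableSet {ω : BondConfig (Site 3) | K₀ < MD[n, M, ω]} :=
      measurableSet_lt measurable_const (Pairing.measurable_md n M)
    have hLm : MeasurableSet {ω : BondConfig (Site 3) | MD[n, M, ω] ≤ K₀} :=
      measurableSet_le (Pairing.measurable_md n M) measurable_const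
    have hintMD : Integrable (fun ω => MD[n, M, ω]) μc :=
      Integrable.of_bound (Pairing.measurable_md n M).aestronglyMeasurable _ (ae_of_all _ fun ω => by
        rw [Real.norm_eq_abs, abs_of_nonneg (Pairing.md_nonneg n M ω)]; exact Pairing.md_le n M ω)
    have hcover : s = (s ∩ {ω : BondConfig (Site 3) | MD[n, M, ω] ≤ K₀}) ∪ (s ∩ {ω : BondConfig (Site 3) | K₀ < MD[n, M, ω]}) := by
      rw [← Set.inter_union_distrib_left]
      refine (Set.inter_eq_left.2 fun ω _ => ?_).symm
      simp only [Set.mem_union, Set.mem_setOf_eq]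
      exact le_or_gt _ _
    have hdisj : Disjoint (s ∩ {ω : BondConfig (Site 3) | MD[n, M, ω] ≤ K₀}) (s ∩ {ω : BondConfig (Site 3) | K₀ < MD[n, M, ω]}) :=
      Set.disjoint_left.2 fun ω h1 h2 => (not_lt.2 (show MD[n, M, ω] ≤ K₀ from h1.2)) (show K₀ < MD[n, M, ω] from h2.2)
    have hsplit : I = (∫ ω in s ∩ {ω : BondConfig (Site 3) | MD[n, M, ω] ≤ K₀}, MD[n, M, ω] ∂μc) +
        ∫ ω in s ∩ {ω : BondConfig (Site 3) | K₀ < MD[n, M, ω]}, MD[n, M, ω] ∂μc := by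
      rw [hI]
      conv_lhs => rw [hcover]
      exact setIntegral_union hdisj (hsm.inter hTm) hintMD.integrableOn hintMD.integrableOn
    have hlow : ∫ ω in s ∩ {ω : BondConfig (Site 3) | MD[n, M, ω] ≤ K₀}, MD[n, M, ω] ∂μc ≤ K' * (μc).real s := by
      have hle : ∫ ω in s ∩ {ω : BondConfig (Site 3) | MD[n, M, ω] ≤ K₀}, MD[n, M, ω] ∂μc ≤
          ∫ _ω in s ∩ {ω : BondConfig (Site 3) | MD[n, M, ω] ≤ K₀}, K' ∂μc :=
        setIntegral_mono_on hintMD.integrableOn integrableOn_const (hsm.inter hLm)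
          fun ω hω => hω.2.trans (le_max_left _ _)
      refine hle.trans ?_
      rw [setIntegral_const, smul_eq_mul, mul_comm]
      exact mul_le_mul_of_nonneg_left (measureReal_mono Set.inter_subset_left) hK'pos.le
    have hfin : (1 - pc) * c / 4 ≤ K' * (μc).real s := by linarith [hsplit, hlow, hK, hIlow]
    refine (min_le_right _ _).trans ?_
    have h4 : 0 < 4 * K' := by positivity
    rw [div_le_iff₀ h4]
    have hst : (μc).real s ≤ (μc).real (BEV[k + 1, n, M]) := measureReal_mono (lev_subset_bev (k + 1) n M)
    nlinarith [hfin, mul_le_mul_of_nonneg_left hst hK'pos.le]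

/-- **Level `k+1 ≥ 1` of the crux from UNIFORM INTEGRABILITY of `MD` on the conclusion level** (strictly weaker than the
second-moment bet: `∫_{MD > K₀} MD ≤ E[MD²]/K₀`). [folklore] -/
theorem levelSucc_of_UI (k l : ℕ) (c : ℝ) (hl : 2 ≤ l) (hc : 0 < c)
    (hUI : ∀ ε : ℝ, 0 < ε → ∃ K₀ : ℝ, ∀ n : ℕ, 1 ≤ n →
      ∫ ω in LEV[n, 2 * l * n, k + 1] ∩ {ω : BondConfig (Site 3) | K₀ < MD[n, 2 * l * n, ω]}, MD[n, 2 * l * n, ω] ∂μc ≤ ε) :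
    ∃ c' : ℝ, 0 < c' ∧ ∀ n : ℕ, 1 ≤ n →
      c ≤ (μc).real (BEV[k + 1 + 1, n, l * n]) → c' ≤ (μc).real (BEV[k + 1, n, 2 * l * n]) := by
  have hq : 0 < 1 - pc := sub_pos.2 pc_lt_one
  obtain ⟨K₀, hK₀⟩ := hUI ((1 - pc) * c / 4) (by positivity)
  refine ⟨min (c / 2) ((1 - pc) * c / (4 * max K₀ 1)), ?_, fun n hn hprem => ?_⟩
  · exact lt_min (by linarith) (div_pos (by positivity) (by positivity))
  · exact level_step_UI hl hn (hK₀ n hn) hprem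

/-- **Certified reduction of the crux to UNIFORM INTEGRABILITY of the discounted closed-pivotal count** (the weakest form of the
line's bet): `∀ k l, 2 ≤ l → ∀ ε > 0, ∃ K₀, ∀ n ≥ 1, ∫_{BUD(n,2ln) = k+1, MD > K₀} MD dP ≤ ε` implies `PercBudgetLadder.PinholeClosing`.
[folklore] -/
theorem pinholeClosing_of_balancedUI
    (hUI : ∀ (k l : ℕ), 2 ≤ l → ∀ ε : ℝ, 0 < ε → ∃ K₀ : ℝ, ∀ n : ℕ, 1 ≤ n →
      ∫ ω in LEV[n, 2 * l * n, k + 1] ∩ {ω : BondConfig (Site 3) | K₀ < MD[n, 2 * l * n, ω]}, MD[n, 2 * l * n, ω] ∂μc ≤ ε) :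
    PercBudgetLadder.PinholeClosing := by
  intro k l c hl hc
  cases k with
  | zero => exact pinholeClosing_zero l c hl hc
  | succ j => exact levelSucc_of_UI j l c hl hc (hUI j l hl)

/-- **Certified reduction of the crux to the bet of the line `balanced-deletion`.**  If, for every level `k` and aspect
`l ≥ 2`, the discounted closed-pivotal count `MD` has a second moment on `{BUD(n, 2ln) = k+1}` bounded uniformly in
`n ≥ 1` (VERBATIM the registered stub `stub_balancedSecondMoment`), then `PercBudgetLadder.PinholeClosing` holds:
level `0` by `pinholeClosing_zero`, level `k+1` by `levelSucc_of_bet`. [folklore] -/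
theorem pinholeClosing_of_balancedSecondMoment
    (hbet : ∀ (k l : ℕ), 2 ≤ l → ∃ K : ℝ, ∀ n : ℕ, 1 ≤ n →
      ∫ ω in {ω : BondConfig (Site 3) |
          minOpenCutIn (↑(box 3 (2 * l * n)) : Set (Site 3)) (↑(box 3 n) : Set (Site 3)) (↑(innerBoundary (zdGraph 3) (box 3 (2 * l * n))) : Set (Site 3)) ω = ((k + 1 : ℕ) : ℕ∞)},
        (∑ f ∈ edgesIn (zdGraph 3) (box 3 (2 * l * n)),
          {η : BondConfig (Site 3) | f ∉ η ∧
              minOpenCutIn (↑(box 3 (2 * l * n)) : Set (Site 3)) (↑(box 3 n) : Set (Site 3)) (↑(innerBoundary (zdGraph 3) (box 3 (2 * l * n))) : Set (Site 3)) η + 1 ≤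
              minOpenCutIn (↑(box 3 (2 * l * n)) : Set (Site 3)) (↑(box 3 n) : Set (Site 3)) (↑(innerBoundary (zdGraph 3) (box 3 (2 * l * n))) : Set (Site 3)) (insert f η)}.indicator
            (fun η => 1 / ∑ b ∈ edgesIn (zdGraph 3) (box 3 (2 * l * n)),
              {ζ : BondConfig (Site 3) | b ∈ ζ ∧
                  minOpenCutIn (↑(box 3 (2 * l * n)) : Set (Site 3)) (↑(box 3 n) : Set (Site 3)) (↑(innerBoundary (zdGraph 3) (box 3 (2 * l * n))) : Set (Site 3)) (ζ \ {b}) + 1 ≤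
                  minOpenCutIn (↑(box 3 (2 * l * n)) : Set (Site 3)) (↑(box 3 n) : Set (Site 3)) (↑(innerBoundary (zdGraph 3) (box 3 (2 * l * n))) : Set (Site 3)) ζ}.indicator
                (fun _ => (1 : ℝ)) (insert f η)) ω) ^ 2
        ∂(bondPercolation (zdGraph 3) (criticalProbI 3)) ≤ K) :
    PercBudgetLadder.PinholeClosing := by
  intro k l c hl hc
  cases k with
  | zero => exact pinholeClosing_zero l c hl hc
  | succ j => exact levelSucc_of_bet j l c hl hc (hbet j l hl)

/-- **Registered form of the L² reduction** (`stub_bdReduction` of the line's skeleton). [folklore] -/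
theorem stub_bdReduction :
    (∀ (k l : ℕ), 2 ≤ l → ∃ K : ℝ, ∀ n : ℕ, 1 ≤ n →
      ∫ ω in {ω : BondConfig (Site 3) | minOpenCutIn (↑(box 3 (2 * l * n)) : Set (Site 3)) (↑(box 3 n) : Set (Site 3)) (↑(innerBoundary (zdGraph 3) (box 3 (2 * l * n))) : Set (Site 3)) ω = ((k + 1 : ℕ) : ℕ∞)},
        (∑ f ∈ edgesIn (zdGraph 3) (box 3 (2 * l * n)),
          {η : BondConfig (Site 3) | f ∉ η ∧
              minOpenCutIn (↑(box 3 (2 * l * n)) : Set (Site 3)) (↑(box 3 n) : Set (Site 3)) (↑(innerBoundary (zdGraph 3) (box 3 (2 * l * n))) : Set (Site 3)) η + 1 ≤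
              minOpenCutIn (↑(box 3 (2 * l * n)) : Set (Site 3)) (↑(box 3 n) : Set (Site 3)) (↑(innerBoundary (zdGraph 3) (box 3 (2 * l * n))) : Set (Site 3)) (insert f η)}.indicator
            (fun η => 1 / ∑ b ∈ edgesIn (zdGraph 3) (box 3 (2 * l * n)),
              {ζ : BondConfig (Site 3) | b ∈ ζ ∧
                  minOpenCutIn (↑(box 3 (2 * l * n)) : Set (Site 3)) (↑(box 3 n) : Set (Site 3)) (↑(innerBoundary (zdGraph 3) (box 3 (2 * l * n))) : Set (Site 3)) (ζ \ {b}) + 1 ≤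
                  minOpenCutIn (↑(box 3 (2 * l * n)) : Set (Site 3)) (↑(box 3 n) : Set (Site 3)) (↑(innerBoundary (zdGraph 3) (box 3 (2 * l * n))) : Set (Site 3)) ζ}.indicator
                (fun _ => (1 : ℝ)) (insert f η)) ω) ^ 2
        ∂(bondPercolation (zdGraph 3) (criticalProbI 3)) ≤ K) →
    Summit.CriticalPhenomena.PercolationContinuityZ3.Theses.PercBudgetLadder.PinholeClosing :=
  pinholeClosing_of_balancedSecondMoment

/-- **Registered form of the UI reduction** (`stub_bdReductionUI` of the line's skeleton). [folklore] -/
theorem stub_bdReductionUI :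
    (∀ (k l : ℕ), 2 ≤ l → ∀ ε : ℝ, 0 < ε → ∃ K₀ : ℝ, ∀ n : ℕ, 1 ≤ n →
      ∫ ω in {ω : BondConfig (Site 3) | minOpenCutIn (↑(box 3 (2 * l * n)) : Set (Site 3)) (↑(box 3 n) : Set (Site 3)) (↑(innerBoundary (zdGraph 3) (box 3 (2 * l * n))) : Set (Site 3)) ω = ((k + 1 : ℕ) : ℕ∞)} ∩
          {ω : BondConfig (Site 3) | K₀ < ∑ f ∈ edgesIn (zdGraph 3) (box 3 (2 * l * n)),
          {η : BondConfig (Site 3) | f ∉ η ∧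
              minOpenCutIn (↑(box 3 (2 * l * n)) : Set (Site 3)) (↑(box 3 n) : Set (Site 3)) (↑(innerBoundary (zdGraph 3) (box 3 (2 * l * n))) : Set (Site 3)) η + 1 ≤
              minOpenCutIn (↑(box 3 (2 * l * n)) : Set (Site 3)) (↑(box 3 n) : Set (Site 3)) (↑(innerBoundary (zdGraph 3) (box 3 (2 * l * n))) : Set (Site 3)) (insert f η)}.indicator
            (fun η => 1 / ∑ b ∈ edgesIn (zdGraph 3) (box 3 (2 * l * n)),
              {ζ : BondConfig (Site 3) | b ∈ ζ ∧
                  minOpenCutIn (↑(box 3 (2 * l * n)) : Set (Site 3)) (↑(box 3 n) : Set (Site 3)) (↑(innerBoundary (zdGraph 3) (box 3 (2 * l * n))) : Set (Site 3)) (ζ \ {b}) + 1 ≤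
                  minOpenCutIn (↑(box 3 (2 * l * n)) : Set (Site 3)) (↑(box 3 n) : Set (Site 3)) (↑(innerBoundary (zdGraph 3) (box 3 (2 * l * n))) : Set (Site 3)) ζ}.indicator
                (fun _ => (1 : ℝ)) (insert f η)) ω},
        (∑ f ∈ edgesIn (zdGraph 3) (box 3 (2 * l * n)),
          {η : BondConfig (Site 3) | f ∉ η ∧
              minOpenCutIn (↑(box 3 (2 * l * n)) : Set (Site 3)) (↑(box 3 n) : Set (Site 3)) (↑(innerBoundary (zdGraph 3) (box 3 (2 * l * n))) : Set (Site 3)) η + 1 ≤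
              minOpenCutIn (↑(box 3 (2 * l * n)) : Set (Site 3)) (↑(box 3 n) : Set (Site 3)) (↑(innerBoundary (zdGraph 3) (box 3 (2 * l * n))) : Set (Site 3)) (insert f η)}.indicator
            (fun η => 1 / ∑ b ∈ edgesIn (zdGraph 3) (box 3 (2 * l * n)),
              {ζ : BondConfig (Site 3) | b ∈ ζ ∧
                  minOpenCutIn (↑(box 3 (2 * l * n)) : Set (Site 3)) (↑(box 3 n) : Set (Site 3)) (↑(innerBoundary (zdGraph 3) (box 3 (2 * l * n))) : Set (Site 3)) (ζ \ {b}) + 1 ≤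
                  minOpenCutIn (↑(box 3 (2 * l * n)) : Set (Site 3)) (↑(box 3 n) : Set (Site 3)) (↑(innerBoundary (zdGraph 3) (box 3 (2 * l * n))) : Set (Site 3)) ζ}.indicator
                (fun _ => (1 : ℝ)) (insert f η)) ω)
        ∂(bondPercolation (zdGraph 3) (criticalProbI 3)) ≤ ε) →
    Summit.CriticalPhenomena.PercolationContinuityZ3.Theses.PercBudgetLadder.PinholeClosing :=
  pinholeClosing_of_balancedUI

end BalancedDeletion

end Summit.CriticalPhenomena.PercolationContinuityZ3.Theorems
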